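import Literature.MathematicalPhysics.QuantumFieldTheory.Balaban1983to89.B3ScalarPropagatorCovariance

/-!
# `Balaban1983to89.B3ScalarPropagatorWick` — T. Bałaban, *(Higgs)₂,₃ quantum fields in a finite volume. III.
Renormalization*, Commun. Math. Phys. **88** (1983) 411–445 [Balaban1983Higgs3], p. 414: **the `φ′`-legs «are again
divided into pairs and each pair is replaced by a propagator, i.e. by G_k(Ω, B̃), …»** — WICK RECURSION for the Gaussian
fluctuation `χ` of the old field (`B3ScalarPropagatorMean.rt14_gaussian_eq`; weight `e^{−½⟨χ̃,G_k(Ω,B̃)^{−1}χ̃⟩}` on the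
fields on `Ω = B^k(Ω^{(k)})`): `∫ ⟨χ̃,g⟩ Π_{i∈s}⟨χ̃,f_i⟩ e^{…} dχ = Σ_{i∈s} ⟨f_i, G_k(Ω,B̃)g⟩ ∫ Π_{l∈s∖i}⟨χ̃,f_l⟩ e^{…} dχ`,
PROVED from the Gaussian integration by parts of `B3ScalarPropagatorCovariance`; theorems only

statement-level skeleton of published theorems with citation tags; proofs where landed; nothing here is a claim about the Yang–Mills mass gap

PDF held: `paper:balaban1983-higgs-2-3-quantum-fields-finite-volume` (journal page = PDF page + 410).

CITATION HEADER (lean-in-tree rule).  lit-balaban typed skeleton (HOME `run/shared/lean/pub/lit-balaban/`), typer line,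
sequel of `B3ScalarPropagatorCovariance` (split off for the cell's file-length cap); located member of the SKELETON rows
**B3.Eq1.12-1.15** and **B3.Eq1.4** (owner r15; cells only, zero head weight).  THE SOURCE TEXT, p. 414 [PDF 4], verbatim:
*"Some φ′-legs are replaced by external scalar fields and the remaining are again divided into pairs and each pair is
replaced by a propagator, i.e. by G_k(Ω, B̃), G_k(Ω₂, B̃), δG_k(Ω, Ω₂, B̃) or the operator (1.16)."* — typed here for the
basic propagator `G_k(Ω, B̃)`.

WHAT IS PROVED (0 sorry; theorems only).  `hasFDerivAt_prodExtLegs` (Leibniz rule for a product of `χ`-legs),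
`abs_prodExtLegs_le` (continuity and exponential growth), **`wick_recursion_chi`** (the recursion; `g` supported in `Ω`,
`msq > 0`, `a_k ≥ 0`), `integral_prodExtLegs_eq_zero_of_odd` (an odd number of legs integrates to `0`),
`integral_four_extLegs` (Isserlis: three pairings, each pair a `G_k(Ω,B̃)`).  HONEST SCOPE as in `B3ScalarPropagatorCovariance` (unnormalised identities against the same weight;
only the propagator `G_k(Ω,B̃)`, not `G_k(Ω₂,B̃)`, `δG_k`, (1.16)).  Unit `lit-balaban-typer` gen 30
(literature-prover-lit-balaban-typer-g30-0); HOME/FILED.md records the proposal.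
-/

open scoped BigOperators InnerProductSpace
open _root_.MeasureTheory

namespace Literature.MathematicalPhysics.QuantumFieldTheory.Balaban1983to89.B3ScalarPropagatorWick

open Literature.MathematicalPhysics.QuantumFieldTheory.Balaban1983to89.HiggsLattice
open Literature.MathematicalPhysics.QuantumFieldTheory.Balaban1983to89.HiggsAveraging
open Literature.MathematicalPhysics.QuantumFieldTheory.Balaban1983to89.HiggsCovariance
open Literature.MathematicalPhysics.QuantumFieldTheory.Balaban1983to89.HiggsCovariancePos
open Literature.MathematicalPhysics.QuantumFieldTheory.Balaban1983to89.HiggsFluctMeasure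
open Literature.MathematicalPhysics.QuantumFieldTheory.Balaban1983to89.HiggsFluctMeasurePos
open Literature.MathematicalPhysics.QuantumFieldTheory.Balaban1983to89.B1Eq230FluctCovPos
open Literature.MathematicalPhysics.QuantumFieldTheory.Balaban1983to89.B3Eq14AuxFunction
open Literature.MathematicalPhysics.QuantumFieldTheory.Balaban1983to89.B3ScalarPropagatorMean
open Literature.MathematicalPhysics.QuantumFieldTheory.Balaban1983to89.B3ScalarPropagatorCovariance

variable {P : HiggsLattice.Params} {N : ℕ}

section Wick

variable (C : ChargeData N) (A : HiggsLattice.VecField P 0) {k : ℕ} (Ωk : Finset (HiggsLattice.Site P k)) {msq : ℝ} (a : ℝ)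

variable {ι : Type*}

/-- Leibniz rule and bounds for a product of `χ`-legs. [cite: Balaban1983Higgs3, (1.4) p.414] -/
theorem hasFDerivAt_prodExtLegs [DecidableEq ι] (Ω : Finset (HiggsLattice.Site P 0)) (s : Finset ι) (f : ι → ScalarField P 0 N)
    (χ : ↥Ω → EuclideanSpace ℝ (Fin N)) :
    ∃ D : (↥Ω → EuclideanSpace ℝ (Fin N)) →L[ℝ] ℝ,
      HasFDerivAt (fun ψ : ↥Ω → EuclideanSpace ℝ (Fin N) => ∏ i ∈ s, siteInner (extendZero Ω ψ) (f i)) D χ ∧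
      ∀ u, D u = ∑ i ∈ s, (∏ l ∈ s.erase i, siteInner (extendZero Ω χ) (f l)) * siteInner (extendZero Ω u) (f i) := by
  choose ℓ hℓ using fun i => exists_clm_extLeg (P := P) (N := N) Ω (f i)
  have hg : ∀ i ∈ s, HasFDerivAt (fun ψ : ↥Ω → EuclideanSpace ℝ (Fin N) => siteInner (extendZero Ω ψ) (f i)) (ℓ i) χ := by
    intro i _
    have : (fun ψ : ↥Ω → EuclideanSpace ℝ (Fin N) => siteInner (extendZero Ω ψ) (f i)) = ℓ i :=
      funext fun ψ => (hℓ i ψ).symm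
    rw [this]
    exact (ℓ i).hasFDerivAt
  refine ⟨_, HasFDerivAt.finsetProd hg, fun u => ?_⟩
  simp only [_root_.sum_apply, _root_.smul_apply, smul_eq_mul, hℓ]

/-- A product of `|s|` `χ`-legs is continuous and `≤ K e^{|s|‖χ‖}`. [cite: Balaban1983Higgs3, (1.4) p.414] -/
theorem abs_prodExtLegs_le (Ω : Finset (HiggsLattice.Site P 0)) (s : Finset ι) (f : ι → ScalarField P 0 N) :
    (Continuous fun ψ : ↥Ω → EuclideanSpace ℝ (Fin N) => ∏ i ∈ s, siteInner (extendZero Ω ψ) (f i)) ∧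
    ∃ K : ℝ, 0 ≤ K ∧ ∀ χ : ↥Ω → EuclideanSpace ℝ (Fin N),
      |∏ i ∈ s, siteInner (extendZero Ω χ) (f i)| ≤ K * Real.exp (s.card * ‖χ‖) := by
  choose ℓ hℓ using fun i => exists_clm_extLeg (P := P) (N := N) Ω (f i)
  refine ⟨continuous_finsetProd _ fun i _ => ?_, ∏ i ∈ s, ‖ℓ i‖, Finset.prod_nonneg fun i _ => norm_nonneg _, fun χ => ?_⟩
  · have : (fun ψ : ↥Ω → EuclideanSpace ℝ (Fin N) => siteInner (extendZero Ω ψ) (f i)) = ℓ i :=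
      funext fun ψ => (hℓ i ψ).symm
    rw [this]
    exact (ℓ i).continuous
  · rw [Finset.abs_prod]
    calc ∏ i ∈ s, |siteInner (extendZero Ω χ) (f i)| ≤ ∏ i ∈ s, (‖ℓ i‖ * Real.exp ‖χ‖) :=
          Finset.prod_le_prod (fun i _ => abs_nonneg _) fun i _ => abs_extLeg_le_of_clm Ω (hℓ i) χ
      _ = (∏ i ∈ s, ‖ℓ i‖) * Real.exp (s.card * ‖χ‖) := by
          rw [Finset.prod_mul_distrib, Finset.prod_const, Real.exp_nat_mul]

/-- **WICK RECURSION FOR THE FLUCTUATION `χ`** — the `χ`-legs (`φ′`-legs after the translation of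
`B3ScalarPropagatorMean.rt14_gaussian_eq`) are contracted in pairs, each pair giving the propagator `G_k(Ω,B̃)`:
`∫ ⟨χ̃,g⟩ Π_{i∈s}⟨χ̃,f_i⟩ e^{−½⟨χ̃,G_k^{−1}χ̃⟩} dχ = Σ_{i∈s} ⟨f_i, G_k(Ω,B̃)g⟩ ∫ Π_{l∈s∖i}⟨χ̃,f_l⟩ e^{−½⟨χ̃,G_k^{−1}χ̃⟩} dχ`
(`g` supported in `Ω`, `msq > 0`, `a_k ≥ 0`). PROVED. [cite: Balaban1983Higgs3, (1.4) p.414] -/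
theorem wick_recursion_chi [DecidableEq ι] (hmsq : 0 < msq) (hak : 0 ≤ B1.aSeq a P.L k) (s : Finset ι)
    (f : ι → ScalarField P 0 N) {g : ScalarField P 0 N} (hg : ∀ x, x ∉ region k Ωk → g x = 0) :
    ∫ χ, siteInner (extendZero (region k Ωk) χ) g * (∏ i ∈ s, siteInner (extendZero (region k Ωk) χ) (f i))
        * Real.exp (-(1 / 2 : ℝ) * siteInner (extendZero (region k Ωk) χ)
            (covOpK C (region k Ωk) A msq a k (extendZero (region k Ωk) χ)))
      = ∑ i ∈ s, siteInner (f i) (propagatorK C (region k Ωk) A msq a k g)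
        * ∫ χ, (∏ l ∈ s.erase i, siteInner (extendZero (region k Ωk) χ) (f l))
            * Real.exp (-(1 / 2 : ℝ) * siteInner (extendZero (region k Ωk) χ)
                (covOpK C (region k Ωk) A msq a k (extendZero (region k Ωk) χ))) := by
  set u : ↥(region k Ωk) → EuclideanSpace ℝ (Fin N) := fun x => propagatorK C (region k Ωk) A msq a k g x.1 with hu
  choose D hD hDu using fun χ => hasFDerivAt_prodExtLegs (P := P) (N := N) (region k Ωk) s f χ
  have hext : extendZero (region k Ωk) u = propagatorK C (region k Ωk) A msq a k g := by
    funext x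
    by_cases hx : x ∈ region k Ωk
    · rw [extendZero_of_mem _ _ hx]
    · rw [extendZero_of_not_mem _ _ hx, propagatorK_apply_of_not_mem C A Ωk msq a hmsq hak hg hx]
  have hpt : ∀ χ, D χ u = ∑ i ∈ s, siteInner (f i) (propagatorK C (region k Ωk) A msq a k g)
      * ∏ l ∈ s.erase i, siteInner (extendZero (region k Ωk) χ) (f l) := fun χ => by
    rw [hDu]
    refine Finset.sum_congr rfl fun i _ => ?_
    rw [hext, siteInner_comm (propagatorK C (region k Ωk) A msq a k g), mul_comm]
  obtain ⟨hc, K, hK0, hK⟩ := abs_prodExtLegs_le (P := P) (N := N) (ι := ι) (region k Ωk) s f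
  have hcK' := fun i => abs_prodExtLegs_le (P := P) (N := N) (ι := ι) (region k Ωk) (s.erase i) f
  choose hc' K' hK'0 hK' using hcK'
  have hDc : Continuous fun χ => D χ u := by
    have : (fun χ => D χ u) = fun χ => ∑ i ∈ s, siteInner (f i) (propagatorK C (region k Ωk) A msq a k g)
        * ∏ l ∈ s.erase i, siteInner (extendZero (region k Ωk) χ) (f l) := funext hpt
    rw [this]
    exact continuous_finsetSum s fun i _ => continuous_const.mul (hc' i)
  have hDb : ∀ χ, |D χ u| ≤ (max K (∑ i ∈ s, |siteInner (f i) (propagatorK C (region k Ωk) A msq a k g)| * K' i))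
      * Real.exp (s.card * ‖χ‖) := fun χ => by
    refine le_trans ?_ (mul_le_mul_of_nonneg_right (le_max_right _ _) (Real.exp_pos _).le)
    rw [hpt, Finset.sum_mul]
    refine (Finset.abs_sum_le_sum_abs _ _).trans (Finset.sum_le_sum fun i hi => ?_)
    rw [abs_mul, mul_assoc]
    refine mul_le_mul_of_nonneg_left ((hK' i χ).trans (mul_le_mul_of_nonneg_left ?_ (hK'0 i))) (abs_nonneg _)
    exact Real.exp_le_exp.2 (mul_le_mul_of_nonneg_right (Nat.cast_le.2 (Finset.card_erase_le)) (norm_nonneg _))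
  have hGb : ∀ χ, |∏ i ∈ s, siteInner (extendZero (region k Ωk) χ) (f i)|
      ≤ (max K (∑ i ∈ s, |siteInner (f i) (propagatorK C (region k Ωk) A msq a k g)| * K' i)) * Real.exp (s.card * ‖χ‖) :=
    fun χ => (hK χ).trans (mul_le_mul_of_nonneg_right (le_max_left _ _) (Real.exp_pos _).le)
  rw [integral_leg_mul_eq_integral_deriv_chi C A Ωk a hmsq hak hg hD hDc hGb hDb]
  show ∫ χ, D χ u * _ = _
  simp_rw [hpt, Finset.sum_mul]
  rw [integral_finsetSum _ fun i _ => ?_]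
  · refine Finset.sum_congr rfl fun i _ => ?_
    simp_rw [mul_assoc]
    exact integral_const_mul _ _
  · simp_rw [mul_assoc]
    exact (integrable_mul_chiWeight_of_abs_le C (region k Ωk) A a k hmsq hak (hc' i) (hK' i)).const_mul _

/-- **An odd number of `χ`-legs integrates to zero against the weight** (legs are contracted in pairs).
[cite: Balaban1983Higgs3, (1.4) p.414] -/
theorem integral_prodExtLegs_eq_zero_of_odd [DecidableEq ι] (hmsq : 0 < msq) (hak : 0 ≤ B1.aSeq a P.L k)
    {f : ι → ScalarField P 0 N} (hf : ∀ i x, x ∉ region k Ωk → f i x = 0) :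
    ∀ (n : ℕ) (s : Finset ι), s.card = n → Odd n →
      ∫ χ, (∏ i ∈ s, siteInner (extendZero (region k Ωk) χ) (f i))
        * Real.exp (-(1 / 2 : ℝ) * siteInner (extendZero (region k Ωk) χ)
            (covOpK C (region k Ωk) A msq a k (extendZero (region k Ωk) χ))) = 0 := by
  intro n
  refine Nat.strong_induction_on n fun n ih => ?_
  intro s hs hodd
  have hpos : 0 < s.card := by
    rw [hs]
    exact hodd.pos
  obtain ⟨i₀, hi₀⟩ := Finset.card_pos.1 hpos
  have hsplit : (fun χ : ↥(region k Ωk) → EuclideanSpace ℝ (Fin N) =>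
        (∏ i ∈ s, siteInner (extendZero (region k Ωk) χ) (f i))
          * Real.exp (-(1 / 2 : ℝ) * siteInner (extendZero (region k Ωk) χ)
              (covOpK C (region k Ωk) A msq a k (extendZero (region k Ωk) χ))))
      = fun χ => siteInner (extendZero (region k Ωk) χ) (f i₀)
          * (∏ i ∈ s.erase i₀, siteInner (extendZero (region k Ωk) χ) (f i))
          * Real.exp (-(1 / 2 : ℝ) * siteInner (extendZero (region k Ωk) χ)
              (covOpK C (region k Ωk) A msq a k (extendZero (region k Ωk) χ))) := by
    funext χ
    rw [← Finset.mul_prod_erase s (fun i => siteInner (extendZero (region k Ωk) χ) (f i)) hi₀]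
  rw [hsplit, wick_recursion_chi C A Ωk a hmsq hak (s.erase i₀) f (hf i₀)]
  refine Finset.sum_eq_zero fun i hi => ?_
  have h1 : (s.erase i₀).card = n - 1 := by rw [Finset.card_erase_of_mem hi₀, hs]
  have h2 : 0 < (s.erase i₀).card := Finset.card_pos.2 ⟨i, hi⟩
  have hcard : ((s.erase i₀).erase i).card = n - 2 := by
    rw [Finset.card_erase_of_mem hi, h1]
    omega
  have hodd' : Odd (n - 2) := by
    obtain ⟨m, hm⟩ := hodd
    exact ⟨m - 1, by omega⟩
  rw [ih (n - 2) (by omega) ((s.erase i₀).erase i) hcard hodd', mul_zero]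

/-- **Four `χ`-legs (Isserlis with the propagator `G_k(Ω,B̃)`)**: three pairings, each pair a `G_k(Ω,B̃)`; all legs supported
in `Ω`. [cite: Balaban1983Higgs3, (1.4) p.414] -/
theorem integral_four_extLegs (hmsq : 0 < msq) (hak : 0 ≤ B1.aSeq a P.L k) {g : ScalarField P 0 N}
    (hg : ∀ x, x ∉ region k Ωk → g x = 0) {f : Fin 3 → ScalarField P 0 N} (hf : ∀ i x, x ∉ region k Ωk → f i x = 0) :
    ∫ χ, siteInner (extendZero (region k Ωk) χ) g * (∏ i, siteInner (extendZero (region k Ωk) χ) (f i))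
        * Real.exp (-(1 / 2 : ℝ) * siteInner (extendZero (region k Ωk) χ)
            (covOpK C (region k Ωk) A msq a k (extendZero (region k Ωk) χ)))
      = (siteInner (f 0) (propagatorK C (region k Ωk) A msq a k g)
            * siteInner (f 2) (propagatorK C (region k Ωk) A msq a k (f 1))
          + siteInner (f 1) (propagatorK C (region k Ωk) A msq a k g)
            * siteInner (f 2) (propagatorK C (region k Ωk) A msq a k (f 0))
          + siteInner (f 2) (propagatorK C (region k Ωk) A msq a k g)
            * siteInner (f 1) (propagatorK C (region k Ωk) A msq a k (f 0)))
        * ∫ χ, Real.exp (-(1 / 2 : ℝ) * siteInner (extendZero (region k Ωk) χ)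
            (covOpK C (region k Ωk) A msq a k (extendZero (region k Ωk) χ))) := by
  have h := wick_recursion_chi C A Ωk a hmsq hak (Finset.univ : Finset (Fin 3)) f hg
  have e0 : (Finset.univ : Finset (Fin 3)).erase 0 = {1, 2} := by decide
  have e1 : (Finset.univ : Finset (Fin 3)).erase 1 = {0, 2} := by decide
  have e2 : (Finset.univ : Finset (Fin 3)).erase 2 = {0, 1} := by decide
  rw [Fin.sum_univ_three, e0, e1, e2] at h
  simp only [Finset.prod_pair (show (1 : Fin 3) ≠ 2 by decide), Finset.prod_pair (show (0 : Fin 3) ≠ 2 by decide),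
    Finset.prod_pair (show (0 : Fin 3) ≠ 1 by decide)] at h
  rw [integral_pair_chi C A Ωk a hmsq hak (f 2) (hf 1), integral_pair_chi C A Ωk a hmsq hak (f 2) (hf 0),
    integral_pair_chi C A Ωk a hmsq hak (f 1) (hf 0)] at h
  rw [h]
  ring

end Wick

end Literature.MathematicalPhysics.QuantumFieldTheory.Balaban1983to89.B3ScalarPropagatorWick
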